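import Mathlib
import Literature.AlgebraicGeometry.Resolution.CossartFunctionNormalForm3
import Literature.AlgebraicGeometry.Resolution.LocalBlowup
import Literature.AlgebraicGeometry.Resolution.TranscendenceDefect
import Literature.RingTheory.PBasis.KimuraNiitsuma1980
import Literature.RingTheory.PBasis.KimuraNiitsuma1980Theorem31
import Summits.ResolutionOfSingularities.ResolutionOfSingularities.Theorems.RadicialJungCleanModelsPBasisAtClosedPoint
import Summits.ResolutionOfSingularities.ResolutionOfSingularities.Theorems.RadicialJungCleanModelsPBasisMonomialIdeal
import Summits.ResolutionOfSingularities.ResolutionOfSingularities.Theorems.RadicialJungCleanModelsPBasisDualDerivations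
import Literature.AlgebraicGeometry.Resolution.RegularLocalRingsProofs
import Mathlib.RingTheory.Jacobson.Ring
import Summits.ResolutionOfSingularities.ResolutionOfSingularities.Theorems.RadicialJungCleanModelsCleanLU3ArcPackage
import HarnessLib

/-!
# Route `RadicialJung`, crux `CleanModels` (stmt-15917) — lens 5, the `k = k̄` anchor of stub :249, part 3/5:
# packaging lemmas and the `p`-basis at the closed centre

Port (res-B-lead-1 g6) of §2, §3 and §8 (G-pb) of the crux workfile `Cruxes/DescentPerfectToAll/Lens5_KbarCossartAnchor.lean` rev 12
(author: res-B-lens-5 g11), proofs verbatim, namespace renamed, DEF-FREE: the workfile's abbreviation `LooseCleanRepAt p S f` (the three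
«loosely clean» exits for a two-term representative `c₀^p + c₁^p f` of the `K^p`-line of `f` at a local subring `S ⊆ K`) is spelled out
in `concl_of_looseCleanRep`.  OURS · counted 0.  Nothing here proves resolution in characteristic `p`; resolution in char `p` is NOT proved.

* `sum_two_eq`, `exists_pow_mul_mem`, `isFractionRing_locAtCentre`, `isFractionRing_of_le'` — packaging (`f := b^p g₀ ∈ A`,
  `c := (c₀, c₁ b, 0, …, 0)`);
* `concl_of_looseCleanRep` — a regular chart `A' ⊇ A` inside `O` at which `b^p g₀` (`b ≠ 0`) has a loosely clean two-term representative
  yields the conclusion of stub :249 (`stub_cleanLU3DefectNonDiscrete`, `Cruxes/CleanModels/Lines/Sketch.lean` rev 26) for `g₀`;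
* `exists_isPBasisOver_locAtCentre` — (G-pb): at `S' = locAtCentre A' O` with `A'` a finitely generated `k`-subalgebra and MAXIMAL centre,
  every regular system of parameters is contained in a `p`-basis of `S'` over `S'^p` (Kimura–Niitsuma 1980 Thm. 3.4 at a closed point,
  ✓ `exists_isPBasisOver_containing_rsop`), `k` ANY field of characteristic `p`.
-/

noncomputable section

set_option linter.dupNamespace false

open IsLocalRing
open Literature.AlgebraicGeometry.Resolution
open Summit.ResolutionOfSingularities.ResolutionOfSingularities.Theorems.RadicialJung.CleanModels
open Literature.RingTheory.PBasis

namespace Summit.ResolutionOfSingularities.ResolutionOfSingularities.Theorems.RadicialJung.CleanModels.Lens5.KbarCossart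

/-! ## Packaging lemmas (anchor §2) -/

variable {K : Type} [Field K]

/-- The two-term representative: with `c = (c₀, c₁', 0, …, 0)`, `∑ c_j^p g₀^j = c₀^p + c₁'^p g₀`. [folklore] -/
theorem sum_two_eq {p : ℕ} [hp : Fact p.Prime] (g₀ c₀ c₁' : K) :
    (∑ j : Fin p, (fun j : Fin p => if (j : ℕ) = 0 then c₀ else if (j : ℕ) = 1 then c₁' else 0) j ^ p *
        g₀ ^ (j : ℕ)) = c₀ ^ p + c₁' ^ p * g₀ := by
  let i₀ : Fin p := ⟨0, hp.out.pos⟩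
  let i₁ : Fin p := ⟨1, hp.out.one_lt⟩
  rw [Finset.sum_eq_add i₀ i₁ (by simp [i₀, i₁, Fin.ext_iff])]
  · simp only [i₀, i₁, if_true, one_ne_zero, if_false, pow_zero, mul_one, pow_one]
  · rintro j - ⟨hj₀, hj₁⟩
    have hj₀' : (j : ℕ) ≠ 0 := fun h => hj₀ (Fin.ext h)
    have hj₁' : (j : ℕ) ≠ 1 := fun h => hj₁ (Fin.ext h)
    simp [hj₀', hj₁', zero_pow hp.out.ne_zero]
  all_goals simp

/-- `b^p g₀ ∈ A` for some nonzero `b ∈ A` (clearing the denominator of `g₀ ∈ K = Frac A`). [folklore] -/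
theorem exists_pow_mul_mem {k : Type} [Field k] [Algebra k K] (p : ℕ) (hp : p.Prime)
    (A : Subalgebra k K) [IsFractionRing A K] (g₀ : K) :
    ∃ b : K, b ≠ 0 ∧ b ∈ A ∧ b ^ p * g₀ ∈ A := by
  obtain ⟨a, b, hb, hab⟩ := IsFractionRing.div_surjective (A := A) g₀
  have hab' : (a : K) / (b : K) = g₀ := hab
  have hb0 : (b : K) ≠ 0 := fun h => nonZeroDivisors.ne_zero hb (Subtype.ext h)
  refine ⟨b, hb0, b.2, ?_⟩
  have : (b : K) ^ p * g₀ = (a : K) * (b : K) ^ (p - 1) := by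
    obtain ⟨q, hq⟩ : ∃ q, p = q + 1 := ⟨p - 1, (Nat.sub_add_cancel hp.one_lt.le).symm⟩
    rw [← hab', hq, Nat.add_sub_cancel, pow_succ]
    field_simp
  rw [this]
  exact A.mul_mem a.2 (A.pow_mem b.2 _)

/-- `locAtCentre A' O` has fraction field `K` when `A ≤ A'` and `Frac A = K`. [folklore] -/
theorem isFractionRing_locAtCentre {k : Type} [Field k] [Algebra k K] {A A' : Subalgebra k K}
    [hfrac : IsFractionRing A K] (hAA' : A ≤ A') (O : ValuationSubring K) :
    IsFractionRing ↥(locAtCentre A'.toSubring O) K := by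
  refine IsFractionRing.of_field _ K fun z => ?_
  obtain ⟨a, b, hb, hab⟩ := IsFractionRing.div_surjective (A := A) z
  have ha' : (a : K) ∈ locAtCentre A'.toSubring O := le_locAtCentre _ O (show (a : K) ∈ A'.toSubring from hAA' a.2)
  have hb' : (b : K) ∈ locAtCentre A'.toSubring O := le_locAtCentre _ O (show (b : K) ∈ A'.toSubring from hAA' b.2)
  exact ⟨⟨a, ha'⟩, ⟨b, hb'⟩, hab.symm⟩

/-- `A'` has fraction field `K` when `A ≤ A'` and `Frac A = K`. [folklore] -/
theorem isFractionRing_of_le' {k : Type} [Field k] [Algebra k K] {A A' : Subalgebra k K}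
    [hfrac : IsFractionRing A K] (hAA' : A ≤ A') : IsFractionRing A' K := by
  refine IsFractionRing.of_field _ K fun z => ?_
  obtain ⟨a, b, hb, hab⟩ := IsFractionRing.div_surjective (A := A) z
  exact ⟨⟨a, hAA' a.2⟩, ⟨b, hAA' b.2⟩, hab.symm⟩



/-! ## The packaging lemma (anchor §3, `LooseCleanRepAt` spelled out) -/

/-- PACKAGING (kernel): a regular chart `A' ⊇ A` inside `O` at which `f = b^p g₀` (`b ≠ 0`) has a loosely clean
two-term representative `c₀^p + c₁^p f`, `c₁ ≠ 0` (forms (1)/(2)/(3) — the conclusion shape of ✓ `stub_looseCleanOfGiraud15`)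
yields the conclusion of stub :249 for `g₀`, with `c := (c₀, c₁ b, 0, …, 0)`. [folklore] -/
theorem concl_of_looseCleanRep {p : ℕ} (hp : p.Prime) {k : Type} [Field k] [Algebra k K]
    (O : ValuationSubring K) (A A' : Subalgebra k K) (hA'O : A'.toSubring ≤ O.toSubring) (hAA' : A ≤ A')
    (hA'fg : A'.FG) [hreg' : IsRegularLocalRing (locAtCentre A'.toSubring O)] (g₀ b : K) (hb0 : b ≠ 0)
    (hrep : ∃ c₀ c₁ : K, c₁ ≠ 0 ∧
      ((∃ (d' m : ℕ) (hmd : m ≤ d') (t' : Fin d' → ↥(locAtCentre A'.toSubring O)) (a' : Fin m → ℕ)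
          (w : ↥(locAtCentre A'.toSubring O)), IsUnit w ∧
          Ideal.span (Set.range t') = maximalIdeal ↥(locAtCentre A'.toSubring O) ∧
          ringKrullDim ↥(locAtCentre A'.toSubring O) = (d' : WithBot ℕ∞) ∧ 0 < m ∧ (∀ i, ¬ p ∣ a' i) ∧
          c₀ ^ p + c₁ ^ p * (b ^ p * g₀) =
            (w : K) * ∏ i : Fin m, ((t' (Fin.castLE hmd i) : ↥(locAtCentre A'.toSubring O)) : K) ^ (a' i)) ∨
       (∃ w : ↥(locAtCentre A'.toSubring O), IsUnit w ∧ c₀ ^ p + c₁ ^ p * (b ^ p * g₀) = (w : K) ∧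
          ∀ c : ↥(locAtCentre A'.toSubring O), w - c ^ p ∉ maximalIdeal ↥(locAtCentre A'.toSubring O)) ∨
       (∃ s c : ↥(locAtCentre A'.toSubring O), c₀ ^ p + c₁ ^ p * (b ^ p * g₀) = (s : K) ∧
          s - c ^ p ∈ maximalIdeal ↥(locAtCentre A'.toSubring O) ∧
          s - c ^ p ∉ maximalIdeal ↥(locAtCentre A'.toSubring O) ^ 2))) :
    ∃ (A' : Subalgebra k K), A'.toSubring ≤ O.toSubring ∧ A ≤ A' ∧ A'.FG ∧
    ∃ (_ : IsRegularLocalRing (locAtCentre A'.toSubring O)) (c : Fin p → K), (∃ j : Fin p, (j : ℕ) ≠ 0 ∧ c j ≠ 0) ∧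
    ((∃ (d m : ℕ) (hmd : m ≤ d) (t : Fin d → ↥(locAtCentre A'.toSubring O)) (a : Fin m → ℕ) (u : ↥(locAtCentre A'.toSubring O)), IsUnit u ∧
    Ideal.span (Set.range t) = IsLocalRing.maximalIdeal ↥(locAtCentre A'.toSubring O) ∧
    ringKrullDim ↥(locAtCentre A'.toSubring O) = (d : WithBot ℕ∞) ∧ 0 < m ∧ (∀ i, ¬ p ∣ a i) ∧
    (∑ j : Fin p, c j ^ p * g₀ ^ (j : ℕ)) = (u : K) * ∏ i : Fin m, ((t (Fin.castLE hmd i) : ↥(locAtCentre A'.toSubring O)) : K) ^ (a i)) ∨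
    (∃ u : ↥(locAtCentre A'.toSubring O), IsUnit u ∧ (∑ j : Fin p, c j ^ p * g₀ ^ (j : ℕ)) = (u : K) ∧
    ∀ c' : ↥(locAtCentre A'.toSubring O), u - c' ^ p ∉ IsLocalRing.maximalIdeal ↥(locAtCentre A'.toSubring O)) ∨
    (∃ s c' : ↥(locAtCentre A'.toSubring O), (∑ j : Fin p, c j ^ p * g₀ ^ (j : ℕ)) = (s : K) ∧
    s - c' ^ p ∈ IsLocalRing.maximalIdeal ↥(locAtCentre A'.toSubring O) ∧
    s - c' ^ p ∉ IsLocalRing.maximalIdeal ↥(locAtCentre A'.toSubring O) ^ 2)) := by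
  classical
  haveI : Fact p.Prime := ⟨hp⟩
  obtain ⟨c₀, c₁, hc₁, hforms⟩ := hrep
  refine ⟨A', hA'O, hAA', hA'fg, hreg',
    fun j : Fin p => if (j : ℕ) = 0 then c₀ else if (j : ℕ) = 1 then c₁ * b else 0, ?_, ?_⟩
  · refine ⟨⟨1, hp.one_lt⟩, one_ne_zero, ?_⟩
    simp only [one_ne_zero, if_false, if_true]
    exact mul_ne_zero hc₁ hb0
  have hsum : (∑ j : Fin p, (fun j : Fin p => if (j : ℕ) = 0 then c₀ else if (j : ℕ) = 1 then c₁ * b else 0) j ^ p *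
      g₀ ^ (j : ℕ)) = c₀ ^ p + c₁ ^ p * (b ^ p * g₀) := by
    rw [sum_two_eq, mul_pow]; ring
  rw [hsum]
  rcases hforms with ⟨d', m, hmd, t', a', w, hw, ht', hd', hm, ha', heq⟩ | ⟨w, hw, heq, hres⟩ | ⟨s, c', heq, hm1, hm2⟩
  · exact Or.inl ⟨d', m, hmd, t', a', w, hw, ht', hd', hm, ha', heq⟩
  · exact Or.inr (Or.inl ⟨w, hw, heq, hres⟩)
  · exact Or.inr (Or.inr ⟨s, c', heq, hm1, hm2⟩)

/-! ## (G-pb) the `p`-basis at the closed centre (anchor §8) -/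


/-- (G-pb) KERNEL — **a `p`-basis of `locAtCentre A' O` over its `p`-th powers containing a prescribed regular system of
parameters**, for `A'` a finitely generated `k`-subalgebra of `K` dominated by `O` with MAXIMAL centre, `k` any field of
characteristic `p` (Kimura–Niitsuma 1980, Thm. 3.4 at a closed point: ✓ `exists_isPBasisOver_containing_rsop`; plumbing as in
✓ `exists_isPBasisOver_stalk`; Kimura–Niitsuma 1980 Thm. 3.4). [folklore] -/
theorem exists_isPBasisOver_locAtCentre (p : ℕ) [Fact p.Prime] (k : Type) [Field k] [CharP k p] (K : Type) [Field K]
    [Algebra k K] (O : ValuationSubring K) (A' : Subalgebra k K) (hA'O : A'.toSubring ≤ O.toSubring) (hA'fg : A'.FG)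
    (hmax : (subringCentre A'.toSubring O hA'O).IsMaximal) [IsRegularLocalRing ↥(locAtCentre A'.toSubring O)]
    [CharP ↥(locAtCentre A'.toSubring O) p] {d : ℕ} (t : Fin d → ↥(locAtCentre A'.toSubring O))
    (ht : Ideal.span (Set.range t) = maximalIdeal ↥(locAtCentre A'.toSubring O))
    (hd : ringKrullDim ↥(locAtCentre A'.toSubring O) = (d : WithBot ℕ∞)) :
    ∃ Γ : Set ↥(locAtCentre A'.toSubring O), Set.range t ⊆ Γ ∧
      IsPBasisOver p (frobenius ↥(locAtCentre A'.toSubring O) p).range Γ := by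
  classical
  have hp : p.Prime := Fact.out
  obtain ⟨t₀, ht₀⟩ := hA'fg
  have hsub : ∀ x ∈ t₀, x ∈ A' := fun x hx => by
    rw [← ht₀]; exact Algebra.subset_adjoin (Finset.mem_coe.mpr hx)
  -- the base `B = A'` as a subring of `K`, a finitely generated `k`-algebra
  let ψ : k →+* ↥A'.toSubring := (algebraMap k K).codRestrict A'.toSubring fun c => A'.algebraMap_mem c
  letI : Algebra k ↥A'.toSubring := ψ.toAlgebra
  let emb : {x // x ∈ t₀} → ↥A'.toSubring := fun x => ⟨x.1, hsub x.1 x.2⟩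
  have hft : Algebra.adjoin k (↑(t₀.attach.image emb) : Set ↥A'.toSubring) = ⊤ := by
    let val : ↥A'.toSubring →ₐ[k] K :=
      { A'.toSubring.subtype with commutes' := fun c => rfl }
    have hval : Function.Injective val := Subtype.val_injective
    have himg : (val '' (↑(t₀.attach.image emb) : Set ↥A'.toSubring)) = (↑t₀ : Set K) := by
      ext x
      constructor
      · rintro ⟨y, hy, rfl⟩
        obtain ⟨a, -, rfl⟩ := Finset.mem_image.mp (Finset.mem_coe.mp hy)
        exact Finset.mem_coe.mpr a.2
      · intro hx
        exact ⟨emb ⟨x, Finset.mem_coe.mp hx⟩, Finset.mem_coe.mpr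
          (Finset.mem_image_of_mem _ (Finset.mem_attach _ _)), rfl⟩
    rw [eq_top_iff]
    rintro b -
    have hb : (b : K) ∈ Algebra.adjoin k (↑t₀ : Set K) := by rw [ht₀]; exact b.2
    rw [← himg, ← AlgHom.map_adjoin] at hb
    obtain ⟨b', hb', hbb'⟩ := hb
    have hb'b : b' = b := hval hbb'
    rw [← hb'b]; exact hb'
  haveI hftI : Algebra.FiniteType k ↥A'.toSubring := ⟨⟨t₀.attach.image emb, hft⟩⟩
  -- `S' = locAtCentre A' O` as the localisation of `B` at the maximal ideal `𝔮`
  haveI := isLocalization_locAtCentre hA'O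
  let φ : k →+* ↥(locAtCentre A'.toSubring O) := (algebraMap ↥A'.toSubring ↥(locAtCentre A'.toSubring O)).comp ψ
  letI : Algebra k ↥(locAtCentre A'.toSubring O) := φ.toAlgebra
  have hφ : ∀ c : k, algebraMap k ↥(locAtCentre A'.toSubring O) c =
      algebraMap ↥A'.toSubring ↥(locAtCentre A'.toSubring O) (algebraMap k ↥A'.toSubring c) := fun _ => rfl
  -- (hgen) ring generation by `p`-th powers, `k` and the algebra generators
  have hgen : ∃ s : Finset ↥(locAtCentre A'.toSubring O), Subring.closure
      (Set.range (frobenius ↥(locAtCentre A'.toSubring O) p) ∪ Set.range (algebraMap k ↥(locAtCentre A'.toSubring O)) ∪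
        ↑s) = ⊤ := by
    refine ⟨(t₀.attach.image emb).image (algebraMap ↥A'.toSubring ↥(locAtCentre A'.toSubring O)), ?_⟩
    set C := Subring.closure
      (Set.range (frobenius ↥(locAtCentre A'.toSubring O) p) ∪ Set.range (algebraMap k ↥(locAtCentre A'.toSubring O)) ∪
        ↑((t₀.attach.image emb).image (algebraMap ↥A'.toSubring ↥(locAtCentre A'.toSubring O)))) with hC
    have hA : ∀ a : ↥A'.toSubring, algebraMap ↥A'.toSubring ↥(locAtCentre A'.toSubring O) a ∈ C := by
      intro a
      have ha : a ∈ (Algebra.adjoin k (↑(t₀.attach.image emb) : Set ↥A'.toSubring)).toSubring := by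
        rw [hft, Algebra.top_toSubring]; exact Subring.mem_top a
      rw [Algebra.adjoin_eq_ring_closure] at ha
      have ha' : algebraMap ↥A'.toSubring ↥(locAtCentre A'.toSubring O) a ∈
          (Subring.closure (Set.range (algebraMap k ↥A'.toSubring) ∪ ↑(t₀.attach.image emb))).map
            (algebraMap ↥A'.toSubring ↥(locAtCentre A'.toSubring O)) := ⟨a, ha, rfl⟩
      rw [RingHom.map_closure] at ha'
      refine (Subring.closure_le.mpr ?_) ha'
      rintro _ ⟨a', ha'', rfl⟩
      rcases ha'' with ⟨c, rfl⟩ | ha''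
      · exact Subring.subset_closure (Or.inl (Or.inr ⟨c, hφ c⟩))
      · exact Subring.subset_closure (Or.inr (Finset.mem_coe.mpr (Finset.mem_image_of_mem _ ha'')))
    have hCpow : ∀ r : ↥(locAtCentre A'.toSubring O), r ^ p ∈ C := fun r =>
      Subring.subset_closure (Or.inl (Or.inl ⟨r, frobenius_def _ _⟩))
    rw [eq_top_iff]
    rintro z -
    obtain ⟨a, b, rfl⟩ := IsLocalization.exists_mk'_eq (subringCentre A'.toSubring O hA'O).primeCompl z
    obtain ⟨u, hu⟩ := IsLocalization.map_units ↥(locAtCentre A'.toSubring O) b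
    have hz : IsLocalization.mk' ↥(locAtCentre A'.toSubring O) a b =
        algebraMap ↥A'.toSubring ↥(locAtCentre A'.toSubring O) a *
          ((u⁻¹ : (↥(locAtCentre A'.toSubring O))ˣ) : ↥(locAtCentre A'.toSubring O)) := by
      rw [Units.eq_mul_inv_iff_mul_eq, hu]
      exact IsLocalization.mk'_spec _ a b
    rw [hz]
    refine C.mul_mem (hA a) (units_inv_mem_subring_of_pow_mem hp.one_lt.le C hCpow u ?_)
    rw [hu]; exact hA _
  -- (hfin) the residue field is finite over `k` (Zariski's lemma for `A'/𝔮`)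
  have hfin : ∃ (n : ℕ) (e : Fin n → ResidueField ↥(locAtCentre A'.toSubring O)), ∀ z, ∃ c : Fin n → k,
      z = ∑ i, residue ↥(locAtCentre A'.toSubring O) (algebraMap k ↥(locAtCentre A'.toSubring O) (c i)) * e i := by
    let 𝔮 := subringCentre A'.toSubring O hA'O
    haveI : 𝔮.IsMaximal := hmax
    letI : Field (↥A'.toSubring ⧸ 𝔮) := Ideal.Quotient.field 𝔮
    haveI : Algebra.FiniteType k (↥A'.toSubring ⧸ 𝔮) := inferInstance
    haveI : Module.Finite k (↥A'.toSubring ⧸ 𝔮) := finite_of_finite_type_of_isJacobsonRing k _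
    obtain ⟨n, e₀, he₀⟩ := Module.Finite.exists_fin (R := k) (M := ↥A'.toSubring ⧸ 𝔮)
    let E := IsLocalization.AtPrime.equivQuotMaximalIdeal 𝔮 ↥(locAtCentre A'.toSubring O)
    have hE : ∀ c : k, E (algebraMap k (↥A'.toSubring ⧸ 𝔮) c) =
        residue ↥(locAtCentre A'.toSubring O) (algebraMap k ↥(locAtCentre A'.toSubring O) c) := by
      intro c
      rw [← Ideal.Quotient.mk_algebraMap, IsLocalization.AtPrime.equivQuotMaximalIdeal_apply_mk, hφ]
      rfl
    refine ⟨n, fun i => E (e₀ i), fun z => ?_⟩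
    obtain ⟨c, hc⟩ := (Submodule.mem_span_range_iff_exists_fun k).mp
      (show E.symm z ∈ Submodule.span k (Set.range e₀) by rw [he₀]; exact Submodule.mem_top)
    refine ⟨c, ?_⟩
    have hz : z = E (E.symm z) := (E.apply_symm_apply z).symm
    rw [hz, ← hc, map_sum]
    refine Finset.sum_congr rfl fun i _ => ?_
    rw [Algebra.smul_def, map_mul, hE]
    rfl
  exact exists_isPBasisOver_containing_rsop p hgen hfin t ht hd

end Summit.ResolutionOfSingularities.ResolutionOfSingularities.Theorems.RadicialJung.CleanModels.Lens5.KbarCossart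

end
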